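import Mathlib
import Summits.ValiantsHypothesis.ValiantsHypothesis.Theorems.BarrierLeverPartitionMinorsHitByVPHiddenStatesBallCutFree
import Summits.ValiantsHypothesis.ValiantsHypothesis.Theorems.BarrierLeverPartitionMinorsHitByVPHiddenStatesBallCutBalanced
import Summits.ValiantsHypothesis.ValiantsHypothesis.Theorems.BarrierLeverPartitionMinorsHitByVPHiddenStatesSecondShellAllT
import Summits.ValiantsHypothesis.ValiantsHypothesis.Theorems.BarrierLeverPartitionMinorsHitByVPHiddenStatesFirstShellAnyH

/-!
# Route BarrierLever — item `PartitionMinorsHitByVP` (stmt-ValiantsHypothesis-19717), line `hidden-states`: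
# ★★ THIRD SHELL — every 3-swap family with a BALANCED coordinate of multiplicity 1 or 2 is served (all `t, h`)

Helper file (`--supports stmt-ValiantsHypothesis-19717`; cell valiant-natproofs, 𝒟-side door (c), registered line
`Cruxes/PartitionMinorsHitByVP/Lines/hidden_states.lean` v9; prover seat val-np-p6 gen 21).  Closes NO item; definition-free.

THE THEOREM (memo HOME/val-np-p6/g21/MEMO-valnp6-g21.md §2).  `𝒰 = B_t(h) ∖ {A₁,A₂,A₃} ∪ {C₁,C₂,C₃}` (`|A_l| = t`, `|C_l| = t + 1`,
`A_l ⊄ C_{l'}`), and a coordinate `x` lies in exactly `k ∈ {1, 2}` of the `A_l` and in exactly `k` of the `C_l`.  Then every injective row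
family in `𝒰` with columns covering `B_t(h)` is served: ★★ `exists_table_threeSwap_of_balanced`.
PROOF = the balanced cut `BallCut.served_of_erase_balanced` at `x`: the LINK is a `k`-swap family at level `t − 1` on `Fin h ∖ {x}` and the
DELETION a `(3 − k)`-swap family at level `t` there; both have `≤ 2` swaps, so they are served by the landed first and second shells
(`SecondShell.exists_table_firstShell_anyH`, val-np-p6 g17; `SecondShell.exists_table_secondShell`, val-np-p6 g20), transported
from `Fin (h − 1)` to the coordinate set `Fin h ∖ {x}` by `BallCut.served_image_of_served` (`served_smallSwap`,
`served_erase_image`).  CENSUS (kit j327904/5/6, val-np-p6 g21): the hypothesis holds for 86.9 % of third-shell families at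
`(t, h) = (3, 7)`, 91.1 % at `(3, 8)`, 93.6 % at `(4, 9)`; with g20's triangular path-table certificates the union is 100 % of every
sample at `t ≥ 3` and 99.76 % / 99.90 % (exhaustive / 20 000) at `(2, 6)` / `(2, 7)`, the residue there being the totally unbalanced
cores around `A = {01,02,12}`, `C = {034,134,234}`.

HONEST LABEL: a ∀`t,h` cell of the THIRD shell (swap distance 3 from the ball) of the conjecture column; it is NOT the registered node
`stub_simplexPairLower`; 19717 stays OPEN; nothing on crux 14610 or VP ≠ VNP.
-/

set_option linter.dupNamespace false

namespace Summit.ValiantsHypothesis.ValiantsHypothesis.Theorems.BarrierLever.HiddenStates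

open Finset

noncomputable section

namespace BallCut

open SymbJoin

/-! ## 1. The first and second shells in the uniform `Fin k`-indexed form -/

/-- **One or two swaps are served** (the landed first and second shells, `Fin k`-indexed, `k ∈ {1, 2}`). -/
theorem served_smallSwap (n t : ℕ) {k : ℕ} (hk : k = 1 ∨ k = 2) (A C : Fin k → Finset (Fin n))
    (hA : ∀ l, (A l).card = t) (hC : ∀ l, (C l).card = t + 1)
    (hAi : Function.Injective A) (hCi : Function.Injective C) (hAC : ∀ l l', ¬ A l ⊆ C l')
    {r : ℕ} (u cols : Fin r → Finset (Fin n)) (hu : Function.Injective u)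
    (hU : ∀ i, ((u i).card ≤ t ∧ ∀ l, u i ≠ A l) ∨ ∃ l, u i = C l)
    (hcols : ∀ J : Finset (Fin n), J.card ≤ t → ∃ kk, cols kk = J) :
    ∃ tx : Option (Fin n) → Fin n → ℂ,
      (Matrix.of fun i kk : Fin r => ∏ a ∈ u i, (tx none a + ∑ q ∈ cols kk, tx (some q) a)).det ≠ 0 := by
  rcases hk with rfl | rfl
  · refine SecondShell.exists_table_firstShell_anyH n t (A 0) (C 0) (hA 0) (hC 0) (hAC 0 0) u cols hu (fun i => ?_) hcols
    rcases hU i with ⟨h1, h2⟩ | ⟨l, hl⟩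
    · exact Or.inl ⟨h1, h2 0⟩
    · exact Or.inr (by rwa [Fin.fin_one_eq_zero l] at hl)
  · have hA01 : A 0 ≠ A 1 := fun h => absurd (hAi h) (by decide)
    have hC01 : C 0 ≠ C 1 := fun h => absurd (hCi h) (by decide)
    refine SecondShell.exists_table_secondShell n t (A 0) (A 1) (C 0) (C 1) (hA 0) (hA 1) (hC 0) (hC 1)
      (hAC 0 0) (hAC 1 1) (hAC 0 1) (hAC 1 0) hA01 hC01 u cols hu (fun i => ?_) hcols
    rcases hU i with ⟨h1, h2⟩ | ⟨l, hl⟩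
    · exact Or.inl ⟨h1, h2 0, h2 1⟩
    · refine Or.inr ?_
      rcases Fin.exists_fin_two.1 (⟨l, hl⟩ : ∃ l : Fin 2, u i = C l) with h0 | h1
      · exact Or.inl h0
      · exact Or.inr h1

/-! ## 2. Transport to the coordinate set `Fin (n+1) ∖ {x}` -/

/-- the image of `Fin n` under `x.succAbove` is everything but `x`. -/
theorem map_succAboveEmb_univ {n : ℕ} (x : Fin (n + 1)) :
    (Finset.univ : Finset (Fin n)).map (Fin.succAboveEmb x) = Finset.univ.erase x := by
  ext y
  simp only [Finset.mem_map, Finset.mem_univ, true_and, Finset.mem_erase, and_true, Fin.coe_succAboveEmb]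
  constructor
  · rintro ⟨z, rfl⟩; exact Fin.succAbove_ne x z
  · intro hy; exact Fin.exists_succAbove_eq hy

/-- pulling a set avoiding `x` back along `x.succAbove` and pushing it forward gives the set back. -/
theorem map_preimage_succAbove {n : ℕ} (x : Fin (n + 1)) (s : Finset (Fin (n + 1))) (hx : x ∉ s) :
    (s.preimage (Fin.succAboveEmb x) (Fin.succAboveEmb x).injective.injOn).map (Fin.succAboveEmb x) = s := by
  ext y
  rw [Finset.mem_map]
  constructor
  · rintro ⟨z, hz, rfl⟩; exact Finset.mem_preimage.1 hz
  · intro hy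
    obtain ⟨z, hz⟩ := Fin.exists_succAbove_eq (show y ≠ x from fun h => hx (h ▸ hy))
    exact ⟨z, Finset.mem_preimage.2 (by rw [Fin.coe_succAboveEmb, hz]; exact hy), by rw [Fin.coe_succAboveEmb, hz]⟩

/-- **Small swap families on `Fin (n+1) ∖ {x}` are served** (bijective-enumeration form on the coordinate set `univ.erase x`):
`k ∈ {1,2}` swaps `(A_l, C_l)` avoiding `x`. -/
theorem served_erase_image (n t : ℕ) (x : Fin (n + 1)) {k : ℕ} (hk : k = 1 ∨ k = 2) (A C : Fin k → Finset (Fin (n + 1)))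
    (hA : ∀ l, (A l).card = t) (hC : ∀ l, (C l).card = t + 1)
    (hAi : Function.Injective A) (hCi : Function.Injective C) (hAC : ∀ l l', ¬ A l ⊆ C l')
    (hxA : ∀ l, x ∉ A l) (hxC : ∀ l, x ∉ C l)
    {r : ℕ} (u cols : Fin r → Finset (Fin (n + 1))) (hu : Function.Injective u)
    (hU : ∀ U, (∃ i, u i = U) ↔ ((U ⊆ Finset.univ.erase x ∧ U.card ≤ t ∧ ∀ l, U ≠ A l) ∨ ∃ l, U = C l))
    (hJ : ∀ J, (∃ kk, cols kk = J) ↔ (J ⊆ Finset.univ.erase x ∧ J.card ≤ t)) :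
    symDet u (fun kk => ((0 : Fin 1), cols kk)) ≠ 0 := by
  classical
  set σ := Fin.succAboveEmb x with hσ
  let A' : Fin k → Finset (Fin n) := fun l => (A l).preimage σ σ.injective.injOn
  let C' : Fin k → Finset (Fin n) := fun l => (C l).preimage σ σ.injective.injOn
  have hA' : ∀ l, (A' l).map σ = A l := fun l => map_preimage_succAbove x (A l) (hxA l)
  have hC' : ∀ l, (C' l).map σ = C l := fun l => map_preimage_succAbove x (C l) (hxC l)
  have hA'c : ∀ l, (A' l).card = t := fun l => by rw [← Finset.card_map σ, hA' l, hA l]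
  have hC'c : ∀ l, (C' l).card = t + 1 := fun l => by rw [← Finset.card_map σ, hC' l, hC l]
  have hA'i : Function.Injective A' := fun l l' hll' => hAi (by rw [← hA' l, ← hA' l']; exact congrArg _ hll')
  have hC'i : Function.Injective C' := fun l l' hll' => hCi (by rw [← hC' l, ← hC' l']; exact congrArg _ hll')
  have hA'C' : ∀ l l', ¬ A' l ⊆ C' l' := fun l l' hsub => hAC l l' (by
    rw [← hA' l, ← hC' l']; exact Finset.map_subset_map.2 hsub)
  refine served_image_of_served n t σ A' C'
    (fun r u cols hu hU hcols => served_smallSwap n t hk A' C' hA'c hC'c hA'i hC'i hA'C' u cols hu hU hcols)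
    u cols hu ?_ ?_
  · intro U
    rw [hU U, map_succAboveEmb_univ]
    simp only [hA', hC']
  · intro J
    rw [hJ J, map_succAboveEmb_univ]

/-! ## 3. ★★ The third-shell balanced cell -/

/-- ★★ **THIRD SHELL, BALANCED COORDINATE.**  Three swaps `(A_l, C_l)` (`|A_l| = t`, `|C_l| = t + 1`, injective, `A_l ⊄ C_{l'}`) and a
coordinate `x` lying in exactly `k` of the `A_l` and exactly `k` of the `C_l`, `k ∈ {1, 2}`: every injective row family in
`B_t(h) ∖ {A_l} ∪ {C_l}` with columns covering `B_t(h)` is served by a table. -/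
theorem exists_table_threeSwap_of_balanced (h t : ℕ) (A C : Fin 3 → Finset (Fin h))
    (hA : ∀ l, (A l).card = t) (hC : ∀ l, (C l).card = t + 1)
    (hAi : Function.Injective A) (hCi : Function.Injective C) (hAC : ∀ l l', ¬ A l ⊆ C l')
    (x : Fin h) (hbal : (Finset.univ.filter fun l => x ∈ A l).card = (Finset.univ.filter fun l => x ∈ C l).card)
    (hk : (Finset.univ.filter fun l => x ∈ A l).card = 1 ∨ (Finset.univ.filter fun l => x ∈ A l).card = 2)
    {r : ℕ} (u cols : Fin r → Finset (Fin h)) (hu : Function.Injective u)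
    (hU : ∀ i, ((u i).card ≤ t ∧ ∀ l, u i ≠ A l) ∨ ∃ l, u i = C l)
    (hcols : ∀ J : Finset (Fin h), J.card ≤ t → ∃ kk, cols kk = J) :
    ∃ tx : Option (Fin h) → Fin h → ℂ,
      (Matrix.of fun i kk : Fin r => ∏ a ∈ u i, (tx none a + ∑ q ∈ cols kk, tx (some q) a)).det ≠ 0 := by
  classical
  -- `h = n + 1` and `t = t' + 1`
  obtain ⟨n, rfl⟩ : ∃ n, h = n + 1 := ⟨h - 1, (Nat.succ_pred_eq_of_pos (Fin.pos x)).symm⟩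
  set IA := Finset.univ.filter fun l : Fin 3 => x ∈ A l with hIA
  set IC := Finset.univ.filter fun l : Fin 3 => x ∈ C l with hIC
  have hIAne : IA.Nonempty := by rw [← Finset.card_pos]; rcases hk with h1 | h2 <;> omega
  obtain ⟨l₀, hl₀⟩ := hIAne
  have hxl₀ : x ∈ A l₀ := (Finset.mem_filter.1 hl₀).2
  obtain ⟨t', rfl⟩ : ∃ t', t = t' + 1 :=
    ⟨t - 1, by have := Finset.card_pos.2 ⟨x, hxl₀⟩; rw [hA l₀] at this; omega⟩
  -- the enumerations are bijections onto the family and the ball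
  obtain ⟨hcinj, hUr, hJr⟩ := rigidity (t' + 1) A C hA hC hAi hCi u cols hu hU hcols
  rw [exists_table_iff_symGood]
  refine served_of_erase_balanced t' A C hA hC hAi hCi Finset.univ x (Finset.mem_univ x) (fun l => Finset.subset_univ _)
    hbal ?_ ?_ u cols hu hcinj (fun U => by rw [hUr U]; simp) (fun J => by rw [hJr J]; simp)
  · -- THE LINK: the `k` swaps through `x`, `x` erased, level `t'`
    intro r' u' cols' hu' hc' hU' hJ'
    set k := IA.card with hk'
    have hICk : IC.card = k := hbal.symm
    let eA : Fin k ↪o Fin 3 := IA.orderEmbOfFin rfl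
    let eC : Fin k ↪o Fin 3 := IC.orderEmbOfFin hICk
    have heA : ∀ j, x ∈ A (eA j) := fun j => by
      have hm : eA j ∈ Finset.univ.filter (fun l : Fin 3 => x ∈ A l) := Finset.orderEmbOfFin_mem IA rfl j
      exact (Finset.mem_filter.1 hm).2
    have heC : ∀ j, x ∈ C (eC j) := fun j => by
      have hm : eC j ∈ Finset.univ.filter (fun l : Fin 3 => x ∈ C l) := Finset.orderEmbOfFin_mem IC hICk j
      exact (Finset.mem_filter.1 hm).2
    have heAsur : ∀ l, x ∈ A l → ∃ j, eA j = l := fun l hl => by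
      have : l ∈ Set.range eA := by
        rw [show Set.range eA = ↑IA from Finset.range_orderEmbOfFin IA rfl]; simp [hIA, hl]
      exact this
    have heCsur : ∀ l, x ∈ C l → ∃ j, eC j = l := fun l hl => by
      have : l ∈ Set.range eC := by
        rw [show Set.range eC = ↑IC from Finset.range_orderEmbOfFin IC hICk]; simp [hIC, hl]
      exact this
    let A₁ : Fin k → Finset (Fin (n + 1)) := fun j => (A (eA j)).erase x
    let C₁ : Fin k → Finset (Fin (n + 1)) := fun j => (C (eC j)).erase x
    have hA₁ : ∀ j, (A₁ j).card = t' := fun j => by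
      have := Finset.card_erase_of_mem (heA j); simp only [A₁]; rw [this, hA]; rfl
    have hC₁ : ∀ j, (C₁ j).card = t' + 1 := fun j => by
      have := Finset.card_erase_of_mem (heC j); simp only [C₁]; rw [this, hC]; rfl
    have hA₁i : Function.Injective A₁ := by
      intro j j' hjj'
      have h1 : A (eA j) = A (eA j') := by
        rw [← Finset.insert_erase (heA j), ← Finset.insert_erase (heA j')]; exact congrArg _ hjj'
      exact eA.injective (hAi h1)
    have hC₁i : Function.Injective C₁ := by
      intro j j' hjj'
      have h1 : C (eC j) = C (eC j') := by
        rw [← Finset.insert_erase (heC j), ← Finset.insert_erase (heC j')]; exact congrArg _ hjj'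
      exact eC.injective (hCi h1)
    have hA₁C₁ : ∀ j j', ¬ A₁ j ⊆ C₁ j' := fun j j' hsub => hAC (eA j) (eC j') (by
      rw [← Finset.insert_erase (heA j), ← Finset.insert_erase (heC j')]
      exact Finset.insert_subset_insert x hsub)
    refine served_erase_image n t' x hk A₁ C₁ hA₁ hC₁ hA₁i hC₁i hA₁C₁ (fun j => Finset.notMem_erase x _)
      (fun j => Finset.notMem_erase x _) u' cols' hu' (fun U => ?_) hJ'
    rw [hU' U]
    have e1 : (∀ l, x ∈ A l → U ≠ (A l).erase x) ↔ ∀ j, U ≠ A₁ j := by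
      constructor
      · intro H j; exact H (eA j) (heA j)
      · intro H l hl; obtain ⟨j, rfl⟩ := heAsur l hl; exact H j
    have e2 : (∃ l, x ∈ C l ∧ U = (C l).erase x) ↔ ∃ j, U = C₁ j := by
      constructor
      · rintro ⟨l, hl, hU⟩; obtain ⟨j, rfl⟩ := heCsur l hl; exact ⟨j, hU⟩
      · rintro ⟨j, hU⟩; exact ⟨eC j, heC j, hU⟩
    rw [e1, e2]
  · -- THE DELETION: the `3 - k` swaps avoiding `x`, level `t' + 1`
    intro r' u' cols' hu' hc' hU' hJ'
    set IA' := Finset.univ.filter fun l : Fin 3 => x ∉ A l with hIA'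
    set IC' := Finset.univ.filter fun l : Fin 3 => x ∉ C l with hIC'
    set k := IA'.card with hk'
    have hk3 : IA.card + k = 3 := by
      have := Finset.card_filter_add_card_filter_not (s := (Finset.univ : Finset (Fin 3))) (fun l => x ∈ A l)
      simpa [hIA, hIA'] using this
    have hICk : IC'.card = k := by
      have := Finset.card_filter_add_card_filter_not (s := (Finset.univ : Finset (Fin 3))) (fun l => x ∈ C l)
      simp only [Finset.card_univ, Fintype.card_fin] at this
      rw [← hIC, ← hbal] at this
      simp only [hIC'] at hk' ⊢
      omega
    have hkk : k = 1 ∨ k = 2 := by rcases hk with h1 | h2 <;> omega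
    let eA : Fin k ↪o Fin 3 := IA'.orderEmbOfFin rfl
    let eC : Fin k ↪o Fin 3 := IC'.orderEmbOfFin hICk
    have heA : ∀ j, x ∉ A (eA j) := fun j => by
      have hm : eA j ∈ Finset.univ.filter (fun l : Fin 3 => x ∉ A l) := Finset.orderEmbOfFin_mem IA' rfl j
      exact (Finset.mem_filter.1 hm).2
    have heC : ∀ j, x ∉ C (eC j) := fun j => by
      have hm : eC j ∈ Finset.univ.filter (fun l : Fin 3 => x ∉ C l) := Finset.orderEmbOfFin_mem IC' hICk j
      exact (Finset.mem_filter.1 hm).2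
    have heAsur : ∀ l, x ∉ A l → ∃ j, eA j = l := fun l hl => by
      have : l ∈ Set.range eA := by
        rw [show Set.range eA = ↑IA' from Finset.range_orderEmbOfFin IA' rfl]; simp [hIA', hl]
      exact this
    have heCsur : ∀ l, x ∉ C l → ∃ j, eC j = l := fun l hl => by
      have : l ∈ Set.range eC := by
        rw [show Set.range eC = ↑IC' from Finset.range_orderEmbOfFin IC' hICk]; simp [hIC', hl]
      exact this
    let A₂ : Fin k → Finset (Fin (n + 1)) := fun j => A (eA j)
    let C₂ : Fin k → Finset (Fin (n + 1)) := fun j => C (eC j)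
    refine served_erase_image n (t' + 1) x hkk A₂ C₂ (fun j => hA _) (fun j => hC _)
      (fun j j' hjj' => eA.injective (hAi hjj')) (fun j j' hjj' => eC.injective (hCi hjj'))
      (fun j j' => hAC _ _) heA heC u' cols' hu' (fun U => ?_) hJ'
    rw [hU' U]
    have e1 : (∀ l, x ∉ A l → U ≠ A l) ↔ ∀ j, U ≠ A₂ j := by
      constructor
      · intro H j; exact H (eA j) (heA j)
      · intro H l hl; obtain ⟨j, rfl⟩ := heAsur l hl; exact H j
    have e2 : (∃ l, x ∉ C l ∧ U = C l) ↔ ∃ j, U = C₂ j := by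
      constructor
      · rintro ⟨l, hl, hU⟩; obtain ⟨j, rfl⟩ := heCsur l hl; exact ⟨j, hU⟩
      · rintro ⟨j, hU⟩; exact ⟨eC j, heC j, hU⟩
    rw [e1, e2]

end BallCut

end

end Summit.ValiantsHypothesis.ValiantsHypothesis.Theorems.BarrierLever.HiddenStates
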